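import Summits.CriticalPhenomena.PercolationContinuityZ3.Theorems.PercNearOneGluingNoHeavyLowerTailSahiHittingPairSixData
import HarnessLib

/-!
# `NoHeavyLowerTail` (stmt-CriticalPhenomena-4575) — order-6 pair-type hitting polynomial: kernel certificates for the slices (2,2)

Support file, seat `prim-l12-p5` (gen 9), `--supports stmt-CriticalPhenomena-4575`.  COMPUTATIONAL: `native_decide` of `SparseBernstein.check` on the pruned
two-variable slices `prune (slice2 p6Data j₀ j₁)` (boxes `3¹³`), and the corresponding nonnegativity on the unit cube (`slice_nonneg_of_check`).  See
`…SahiHittingPairSixData` for the data and the slicing lemma, `…SahiHittingPairSix` for the assembly. [this work]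
-/

namespace Summit.CriticalPhenomena.PercolationContinuityZ3.Theorems

namespace SahiHitting

open Finset SparseBernstein Literature.Combinatorics.Sahi2008

/-- The slice `(2,2)` of `P₆|_{pairs}` passes `SparseBernstein.check` on the `3¹³` box. [this work] -/
theorem p6_check_22 : check (tableOfList (prune (slice2 p6Data 2 2))) sliceDeg = true := by
  native_decide

/-- Hence the slice `(2,2)` is nonnegative on the unit cube. [this work] -/
theorem p6_slice_nonneg_22 {x : Fin 15 → ℝ} (hx : ∀ i, 0 ≤ x i ∧ x i ≤ 1) : 0 ≤ evalLV (slice2 p6Data 2 2) x :=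
  slice_nonneg_of_check p6Data 2 2 (slice_deg p6Data p6_deg_mem 2 2) p6_check_22 hx

end SahiHitting

end Summit.CriticalPhenomena.PercolationContinuityZ3.Theorems
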